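import Literature.NumberTheory.GaloisRepresentations.SUnitsLayerInflation
import Literature.NumberTheory.GaloisRepresentations.SUnitsIdeleBridge
import Literature.NumberTheory.GaloisRepresentations.UnramifiedRadicalDescentAbsolute
import HarnessLib

/-!
# Transport between the two direct systems `Hⁿ(Gal(E/F₀), 𝒪_{E,S}ˣ)`: the integral model
# (`SUnits.sUnitsRep`, inflations `layerInf`) and the idelic model (`sUnitsIdeleRep`, `sUnitsIdeleInf`)
# (NSW VIII §3, (8.3.9)–(8.3.11))

Topic `NumberTheory/GaloisRepresentations`; namespace
`Literature.NumberTheory.GaloisRepresentations.SUnits.Layers`.  THEOREMS ONLY (no definition, no named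
fact, no `sorry`, no instance; D-0026).  Lane «PT3-TC» of cell `bsd-eis` (crux `GoodLatticeBDPValue`,
stmt-BirchSwinnertonDyer-19032; road memo `PT3TC-ROAD.md`): the glue between the idelic finite-layer
chases (NSW (8.3.11) (iii)/(iv), `IdeleSUnitsLayerChase*`, stated for `sUnitsIdeleInf`) and the LAYER
SUPPLY statements (A4-iii)/(A4-iv), stated for `layerInf` of `SUnitsLayerInflation.lean`.

* §1 **`map_sUnitsBridge_bijective`** — `Hⁿ` of the bridge isomorphism
  `SUnits.sUnitsRep K S F E ≅ sUnitsIdeleRep F E S_F` (`SUnitsIdeleBridge.lean`) is bijective (with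
  `…_injective`, `…_surjective`): `groupCohomology.map id` is functorial (Mathlib `map_id_comp`, `map_id`).
* §2 **`layerInf_layerInf_comp_map_sUnitsBridge`** — for intermediate fields `F₀ ≤ E ≤ E₁ ≤ E₂` of
  `K̄/K` (`E`, `E₁` normal over `K`, inclusion algebras `algOfLE`), the square
  `layerInf_{E→E₂} ≫ Hⁿ(bridge_{E₂}) = Hⁿ(bridge_E) ≫ sUnitsIdeleInf_{E→E₁} ≫ sUnitsIdeleInf_{E₁→E₂}`
  (the square `sUnitsRepInf_comp_map_sUnitsBridge` of `SUnitsIdeleBridge.lean` twice and the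
  transitivity `layerInf_comp`), and its applied form `map_sUnitsBridge_layerInf_eq`.
* §3 **`isUnramifiedIn_algOfLE_of_ramificationSubgroup_le_galFixing`** — unramified descent along
  `K ≤ F₀ ≤ E`: a layer `E ⊆ K_S` (`N_S ≤ galFixing K E`) is unramified over `F₀` at every place `u` of
  `F₀` not above `S` (tree `isUnramifiedIn_of_ramificationSubgroup_le_galFixing` over `K` + Mathlib
  `Algebra.FormallyUnramified.of_restrictScalars`) — the hypothesis `hS` of the idelic chases.

HONEST FRAMING: plumbing; no cohomology group is computed and no case of Poitou–Tate / BSD is proved.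

## References
* J. Neukirch, A. Schmidt, K. Wingberg, *Cohomology of Number Fields*, 2nd ed. (2008), VIII §3,
  (8.3.9)–(8.3.11). [NeukirchSchmidtWingberg2008]
* D. Harari, *Galois Cohomology and Class Field Theory* (2020), Lemma 15.39, §17.4 (17.1). [Harari2020]
-/

noncomputable section

open NumberField IsDedekindDomain CategoryTheory
open Literature.NumberTheory.GaloisRepresentations.OpenSubgroupLayer (algOfLE isScalarTower_algOfLE)
open Literature.NumberTheory.GaloisRepresentations.IdeleCohomology

namespace Literature.NumberTheory.GaloisRepresentations

namespace SUnits

namespace Layers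

/-! ### §1. `Hⁿ` of the bridge isomorphism is bijective -/

section Bridge

variable {K F E : Type} [Field K] [NumberField K] [Field F] [NumberField F] [Field E] [NumberField E]
  [Algebra K F] [Algebra K E] [Algebra F E] [IsScalarTower K F E]
  (S : Set (HeightOneSpectrum (𝓞 K))) (S_F : Finset (HeightOneSpectrum (𝓞 F)))

/-- `Hⁿ(𝟙, e)` for an isomorphism `e` of representations is bijective (functoriality of
`groupCohomology.map (MonoidHom.id _)`). [folklore] -/
private theorem map_id_bijective_of_iso {G : Type} [Group G] {A B : Rep ℤ G} (e : A ≅ B) (n : ℕ) :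
    Function.Bijective (groupCohomology.map (MonoidHom.id G) e.hom n) := by
  have h1 : groupCohomology.map (MonoidHom.id G) e.hom n ≫ groupCohomology.map (MonoidHom.id G) e.inv n = 𝟙 _ := by
    rw [← groupCohomology.map_id_comp, e.hom_inv_id, groupCohomology.map_id]
  have h2 : groupCohomology.map (MonoidHom.id G) e.inv n ≫ groupCohomology.map (MonoidHom.id G) e.hom n = 𝟙 _ := by
    rw [← groupCohomology.map_id_comp, e.inv_hom_id, groupCohomology.map_id]
  let i : groupCohomology A n ≅ groupCohomology B n :=
    ⟨groupCohomology.map (MonoidHom.id G) e.hom n, groupCohomology.map (MonoidHom.id G) e.inv n, h1, h2⟩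
  change Function.Bijective i.hom
  exact i.toLinearEquiv.bijective

/-- **`Hⁿ(bridge) : Hⁿ(Gal(E/F), 𝒪_{E,S}ˣ) → Hⁿ(Gal(E/F), principal S_F-idèles)` is bijective** (the bridge
`SUnits.sUnitsRep K S F E ≅ sUnitsIdeleRep F E S_F` of `SUnitsIdeleBridge.lean` is an isomorphism).
[cite: Harari2020, Lemma 15.39] [cite: NeukirchSchmidtWingberg2008, VIII §3 (8.3.9)] -/
theorem map_sUnitsBridge_bijective [IsGalois F E]
    (hSF : ∀ u : HeightOneSpectrum (𝓞 F), u ∈ S_F ↔ u.under (𝓞 K) ∈ S) (n : ℕ) :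
    Function.Bijective (groupCohomology.map (A := sUnitsRep K S F E) (B := sUnitsIdeleRep F E S_F)
      (MonoidHom.id (E ≃ₐ[F] E)) (sUnitsBridge (E := E) S S_F hSF) n) :=
  map_id_bijective_of_iso (sUnitsBridgeIso (E := E) S S_F hSF) n

/-- Injectivity half of `map_sUnitsBridge_bijective`. [cite: Harari2020, Lemma 15.39] -/
theorem map_sUnitsBridge_injective [IsGalois F E]
    (hSF : ∀ u : HeightOneSpectrum (𝓞 F), u ∈ S_F ↔ u.under (𝓞 K) ∈ S) (n : ℕ) :
    Function.Injective (groupCohomology.map (A := sUnitsRep K S F E) (B := sUnitsIdeleRep F E S_F)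
      (MonoidHom.id (E ≃ₐ[F] E)) (sUnitsBridge (E := E) S S_F hSF) n) :=
  (map_sUnitsBridge_bijective S S_F hSF n).1

/-- Surjectivity half of `map_sUnitsBridge_bijective`. [cite: Harari2020, Lemma 15.39] -/
theorem map_sUnitsBridge_surjective [IsGalois F E]
    (hSF : ∀ u : HeightOneSpectrum (𝓞 F), u ∈ S_F ↔ u.under (𝓞 K) ∈ S) (n : ℕ) :
    Function.Surjective (groupCohomology.map (A := sUnitsRep K S F E) (B := sUnitsIdeleRep F E S_F)
      (MonoidHom.id (E ≃ₐ[F] E)) (sUnitsBridge (E := E) S S_F hSF) n) :=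
  (map_sUnitsBridge_bijective S S_F hSF n).2

end Bridge

/-! ### §2. The square `layerInf ≫ Hⁿ(bridge) = Hⁿ(bridge) ≫ sUnitsIdeleInf ≫ sUnitsIdeleInf` -/

section Square

variable {K : Type} [Field K] [NumberField K] (S : Set (HeightOneSpectrum (𝓞 K)))

/-- **The two-step square**: for intermediate fields `F₀ ≤ E ≤ E₁ ≤ E₂` of `K̄/K` (`E`, `E₁` normal over
`K`, all finite over `K`, inclusion algebras), a finite set `S₀` of places of `F₀` above `S`, and `n`,
`layerInf_{E→E₂} ≫ Hⁿ(bridge_{E₂}) = Hⁿ(bridge_E) ≫ sUnitsIdeleInf_{E→E₁} ≫ sUnitsIdeleInf_{E₁→E₂}`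
(`sUnitsRepInf_comp_map_sUnitsBridge` twice, `layerInf_comp`).
[cite: NeukirchSchmidtWingberg2008, VIII §3 (8.3.11)] [cite: Harari2020, §17.4 (17.1)] -/
theorem layerInf_layerInf_comp_map_sUnitsBridge {F₀ E E₁ E₂ : IntermediateField K (AlgebraicClosure K)}
    (hF : F₀ ≤ E) (h₁ : E ≤ E₁) (h₂ : E₁ ≤ E₂) [FiniteDimensional K E] [FiniteDimensional K E₁]
    [FiniteDimensional K E₂] [IsGalois K E] [IsGalois K E₁] [IsGalois K E₂]
    (S₀ : Finset (HeightOneSpectrum (𝓞 F₀)))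
    (hSF : ∀ u : HeightOneSpectrum (𝓞 F₀), u ∈ S₀ ↔ u.under (𝓞 K) ∈ S) (n : ℕ) :
    letI := algOfLE hF
    letI := algOfLE h₁
    letI := algOfLE h₂
    letI := algOfLE (hF.trans h₁)
    letI := algOfLE ((hF.trans h₁).trans h₂)
    haveI : FiniteDimensional K F₀ :=
      FiniteDimensional.of_injective (IntermediateField.inclusion hF).toLinearMap
        (IntermediateField.inclusion hF).injective
    haveI : NumberField F₀ := NumberField.of_module_finite K F₀
    haveI : NumberField E := NumberField.of_module_finite K E
    haveI : NumberField E₁ := NumberField.of_module_finite K E₁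
    haveI : NumberField E₂ := NumberField.of_module_finite K E₂
    haveI := isScalarTower_algOfLE (K := K) hF
    haveI := isScalarTower_algOfLE (K := K) (hF.trans h₁)
    haveI := isScalarTower_algOfLE (K := K) ((hF.trans h₁).trans h₂)
    haveI := isScalarTower_algOfLE₃ hF h₁
    haveI := isScalarTower_algOfLE₃ (hF.trans h₁) h₂
    haveI : IsGalois F₀ E := IsGalois.tower_top_of_isGalois K F₀ E
    haveI : IsGalois F₀ E₁ := IsGalois.tower_top_of_isGalois K F₀ E₁
    haveI : IsGalois F₀ E₂ := IsGalois.tower_top_of_isGalois K F₀ E₂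
    layerInf S hF (h₁.trans h₂) n ≫
        groupCohomology.map (MonoidHom.id _) (sUnitsBridge (K := K) (F := F₀) (E := E₂) S S₀ hSF) n =
      groupCohomology.map (MonoidHom.id _) (sUnitsBridge (K := K) (F := F₀) (E := E) S S₀ hSF) n ≫
        sUnitsIdeleInf F₀ E E₁ S₀ n ≫ sUnitsIdeleInf F₀ E₁ E₂ S₀ n := by
  letI := algOfLE hF
  letI := algOfLE h₁
  letI := algOfLE h₂
  letI := algOfLE (hF.trans h₁)
  letI := algOfLE ((hF.trans h₁).trans h₂)
  haveI : FiniteDimensional K F₀ :=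
    FiniteDimensional.of_injective (IntermediateField.inclusion hF).toLinearMap
      (IntermediateField.inclusion hF).injective
  haveI : NumberField F₀ := NumberField.of_module_finite K F₀
  haveI : NumberField E := NumberField.of_module_finite K E
  haveI : NumberField E₁ := NumberField.of_module_finite K E₁
  haveI : NumberField E₂ := NumberField.of_module_finite K E₂
  haveI := isScalarTower_algOfLE (K := K) hF
  haveI := isScalarTower_algOfLE (K := K) h₁
  haveI := isScalarTower_algOfLE (K := K) h₂
  haveI := isScalarTower_algOfLE (K := K) (hF.trans h₁)
  haveI := isScalarTower_algOfLE (K := K) ((hF.trans h₁).trans h₂)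
  haveI := isScalarTower_algOfLE₃ hF h₁
  haveI := isScalarTower_algOfLE₃ (hF.trans h₁) h₂
  haveI : IsGalois F₀ E := IsGalois.tower_top_of_isGalois K F₀ E
  haveI : IsGalois F₀ E₁ := IsGalois.tower_top_of_isGalois K F₀ E₁
  haveI : IsGalois F₀ E₂ := IsGalois.tower_top_of_isGalois K F₀ E₂
  haveI := normal_algOfLE (K := K) hF
  haveI := normal_algOfLE (K := K) (hF.trans h₁)
  rw [← layerInf_comp S hF h₁ h₂ n, Category.assoc, layerInf_eq_sUnitsRepInf S (hF.trans h₁) h₂ n,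
    sUnitsRepInf_comp_map_sUnitsBridge (K := K) (F := F₀) (E := E₁) (E' := E₂) S S₀ hSF n,
    ← Category.assoc, layerInf_eq_sUnitsRepInf S hF h₁ n,
    sUnitsRepInf_comp_map_sUnitsBridge (K := K) (F := F₀) (E := E) (E' := E₁) S S₀ hSF n,
    Category.assoc]

/-- **Applied form**: `Hⁿ(bridge_{E₂}) (layerInf_{E→E₂} c) = sUnitsIdeleInf_{E₁→E₂} (sUnitsIdeleInf_{E→E₁} (Hⁿ(bridge_E) c))`.
[cite: NeukirchSchmidtWingberg2008, VIII §3 (8.3.11)] -/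
theorem map_sUnitsBridge_layerInf_eq {F₀ E E₁ E₂ : IntermediateField K (AlgebraicClosure K)}
    (hF : F₀ ≤ E) (h₁ : E ≤ E₁) (h₂ : E₁ ≤ E₂) [FiniteDimensional K E] [FiniteDimensional K E₁]
    [FiniteDimensional K E₂] [IsGalois K E] [IsGalois K E₁] [IsGalois K E₂]
    (S₀ : Finset (HeightOneSpectrum (𝓞 F₀)))
    (hSF : ∀ u : HeightOneSpectrum (𝓞 F₀), u ∈ S₀ ↔ u.under (𝓞 K) ∈ S) (n : ℕ)
    (c : letI := algOfLE hF; groupCohomology (sUnitsRep K S F₀ E) n) :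
    letI := algOfLE hF
    letI := algOfLE h₁
    letI := algOfLE h₂
    letI := algOfLE (hF.trans h₁)
    letI := algOfLE ((hF.trans h₁).trans h₂)
    haveI : FiniteDimensional K F₀ :=
      FiniteDimensional.of_injective (IntermediateField.inclusion hF).toLinearMap
        (IntermediateField.inclusion hF).injective
    haveI : NumberField F₀ := NumberField.of_module_finite K F₀
    haveI : NumberField E := NumberField.of_module_finite K E
    haveI : NumberField E₁ := NumberField.of_module_finite K E₁
    haveI : NumberField E₂ := NumberField.of_module_finite K E₂
    haveI := isScalarTower_algOfLE (K := K) hF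
    haveI := isScalarTower_algOfLE (K := K) (hF.trans h₁)
    haveI := isScalarTower_algOfLE (K := K) ((hF.trans h₁).trans h₂)
    haveI := isScalarTower_algOfLE₃ hF h₁
    haveI := isScalarTower_algOfLE₃ (hF.trans h₁) h₂
    haveI : IsGalois F₀ E := IsGalois.tower_top_of_isGalois K F₀ E
    haveI : IsGalois F₀ E₁ := IsGalois.tower_top_of_isGalois K F₀ E₁
    haveI : IsGalois F₀ E₂ := IsGalois.tower_top_of_isGalois K F₀ E₂
    groupCohomology.map (MonoidHom.id _) (sUnitsBridge (K := K) (F := F₀) (E := E₂) S S₀ hSF) n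
        (layerInf S hF (h₁.trans h₂) n c) =
      sUnitsIdeleInf F₀ E₁ E₂ S₀ n (sUnitsIdeleInf F₀ E E₁ S₀ n
        (groupCohomology.map (MonoidHom.id _) (sUnitsBridge (K := K) (F := F₀) (E := E) S S₀ hSF) n c)) := by
  have h := layerInf_layerInf_comp_map_sUnitsBridge S hF h₁ h₂ S₀ hSF n
  have h' := ConcreteCategory.congr_hom h c
  simpa only [CategoryTheory.comp_apply] using h'

end Square

/-! ### §3. Unramified descent along `K ≤ F₀ ≤ E` -/

section Unramified

variable {K : Type} [Field K] [NumberField K] (S : Set (HeightOneSpectrum (𝓞 K)))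

/-- **A layer `E ⊆ K_S` is unramified over `F₀` outside the places above `S`**: for `F₀ ≤ E`
intermediate fields of `K̄/K` with `E/K` finite Galois and `N_S ≤ Gal(K̄/E)`, and a finite place `u`
of `F₀` with `u ∩ K ∉ S`, the prime `u` is unramified in `𝓞_E` over `𝓞_{F₀}` (unramified over `K` at
`u ∩ K` by the tree's `isUnramifiedIn_of_ramificationSubgroup_le_galFixing`; a prime of `E` over `u`
lies over `u ∩ K`, and formal unramifiedness descends along `𝓞_K → 𝓞_{F₀}`, Mathlib
`Algebra.FormallyUnramified.of_restrictScalars`).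
[cite: NeukirchSchmidtWingberg2008, VIII §3 (`K_S/K` unramified outside `S`)] -/
theorem isUnramifiedIn_algOfLE_of_ramificationSubgroup_le_galFixing
    {F₀ E : IntermediateField K (AlgebraicClosure K)} (hF : F₀ ≤ E) [FiniteDimensional K E]
    [IsGalois K E] (hS : ramificationSubgroup K S ≤ LocalWeilDatum.galFixing K E)
    (u : HeightOneSpectrum (𝓞 F₀)) (hu : u.under (𝓞 K) ∉ S) :
    letI := algOfLE hF
    Algebra.IsUnramifiedIn (R := 𝓞 F₀) (𝓞 E) u.asIdeal := by
  letI := algOfLE hF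
  haveI := isScalarTower_algOfLE (K := K) hF
  haveI : NumberField E := NumberField.of_module_finite K E
  have hK : Algebra.IsUnramifiedIn (R := 𝓞 K) (𝓞 E) (u.under (𝓞 K)).asIdeal :=
    isUnramifiedIn_of_ramificationSubgroup_le_galFixing K E hS hu
  intro 𝔓 h𝔓 hover
  haveI := h𝔓
  haveI := hover
  haveI : 𝔓.LiesOver (u.under (𝓞 K)).asIdeal := by
    change 𝔓.LiesOver (u.asIdeal.under (𝓞 K))
    exact Ideal.LiesOver.trans 𝔓 u.asIdeal (u.asIdeal.under (𝓞 K))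
  have h1 : Algebra.IsUnramifiedAt (𝓞 K) 𝔓 := hK 𝔓 h𝔓 inferInstance
  exact Algebra.FormallyUnramified.of_restrictScalars (𝓞 K) (𝓞 F₀) (Localization.AtPrime 𝔓)

end Unramified

end Layers

end SUnits

end Literature.NumberTheory.GaloisRepresentations

end
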